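/-
Summits.CriticalPhenomena.TribunalEnv — GENERATED by harness/kit/tribunal_env.py (2026-08-20T23:43:35Z); import-only aggregate for the kernel tribunal (D-0034).
NEVER import this from a Theorems/Theses/Cruxes file (gate4 2026-08-17). Regenerate + `ledger build Summits.CriticalPhenomena.TribunalEnv` together (≤ hourly).
Contents: 5 Statement modules, strong-hypothesis library present, 242 Theses, 391 criterion/converse theorem modules (of 396 candidates; cap), 0 unbuilt skipped, 5 excluded after check.
Full lists: run/shared/lean/tribunal/env/CriticalPhenomena.json
-/
import Summits.CriticalPhenomena.Statement
import Summits.CriticalPhenomena.CardyFormulaZ2.Statement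
import Summits.CriticalPhenomena.Ising3DConformalLimit.Statement
import Summits.CriticalPhenomena.PercolationContinuityZ3.Statement
import Summits.CriticalPhenomena.SAWScalingLimit.Statement
import Literature.StrongHypotheses.CriticalPhenomena
import Summits.CriticalPhenomena.StrongHypotheses
import Summits.CriticalPhenomena.CardyFormulaZ2.Theses.AngleDoublingExponents
import Summits.CriticalPhenomena.CardyFormulaZ2.Theses.CardyAnchoredRigidity
import Summits.CriticalPhenomena.CardyFormulaZ2.Theses.CardyBlackNoise
import Summits.CriticalPhenomena.CardyFormulaZ2.Theses.CardyBondTriangular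
import Summits.CriticalPhenomena.CardyFormulaZ2.Theses.CardyBoundaryCoulombGas
import Summits.CriticalPhenomena.CardyFormulaZ2.Theses.CardyCapacityWard
import Summits.CriticalPhenomena.CardyFormulaZ2.Theses.CardyComplexCone
import Summits.CriticalPhenomena.CardyFormulaZ2.Theses.CardyCornerFugacity
import Summits.CriticalPhenomena.CardyFormulaZ2.Theses.CardyDiluteOrbit
import Summits.CriticalPhenomena.CardyFormulaZ2.Theses.CardyDiscreteHolo
import Summits.CriticalPhenomena.CardyFormulaZ2.Theses.CardyDualCurrent
import Summits.CriticalPhenomena.CardyFormulaZ2.Theses.CardyExpCovariance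
import Summits.CriticalPhenomena.CardyFormulaZ2.Theses.CardyFlipRusso
import Summits.CriticalPhenomena.CardyFormulaZ2.Theses.CardyGluingRDE
import Summits.CriticalPhenomena.CardyFormulaZ2.Theses.CardyHarmonicInvariants
import Summits.CriticalPhenomena.CardyFormulaZ2.Theses.CardyHausdorffMoment
import Summits.CriticalPhenomena.CardyFormulaZ2.Theses.CardyIKTransport
import Summits.CriticalPhenomena.CardyFormulaZ2.Theses.CardyIsoradial
import Summits.CriticalPhenomena.CardyFormulaZ2.Theses.CardyLeeYang
import Summits.CriticalPhenomena.CardyFormulaZ2.Theses.CardyLocalRigidity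
import Summits.CriticalPhenomena.CardyFormulaZ2.Theses.CardyLogModulus
import Summits.CriticalPhenomena.CardyFormulaZ2.Theses.CardyMagicRigidity
import Summits.CriticalPhenomena.CardyFormulaZ2.Theses.CardyMaterialLaw
import Summits.CriticalPhenomena.CardyFormulaZ2.Theses.CardyMeckeFlip
import Summits.CriticalPhenomena.CardyFormulaZ2.Theses.CardyMirrorMonotone
import Summits.CriticalPhenomena.CardyFormulaZ2.Theses.CardyMonotoneApproach
import Summits.CriticalPhenomena.CardyFormulaZ2.Theses.CardyNeumannHarmonic
import Summits.CriticalPhenomena.CardyFormulaZ2.Theses.CardyObliqueExplorer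
import Summits.CriticalPhenomena.CardyFormulaZ2.Theses.CardyOrderDuality
import Summits.CriticalPhenomena.CardyFormulaZ2.Theses.CardyPerronTeleport
import Summits.CriticalPhenomena.CardyFormulaZ2.Theses.CardyPickBootstrap
import Summits.CriticalPhenomena.CardyFormulaZ2.Theses.CardyPolygonWords
import Summits.CriticalPhenomena.CardyFormulaZ2.Theses.CardyQContinuation
import Summits.CriticalPhenomena.CardyFormulaZ2.Theses.CardyRetileGlue
import Summits.CriticalPhenomena.CardyFormulaZ2.Theses.CardyRotToConf
import Summits.CriticalPhenomena.CardyFormulaZ2.Theses.CardyScaleErgodic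
import Summits.CriticalPhenomena.CardyFormulaZ2.Theses.CardySectorGap
import Summits.CriticalPhenomena.CardyFormulaZ2.Theses.CardySegmentWeakRSW
import Summits.CriticalPhenomena.CardyFormulaZ2.Theses.CardySelfDualSegment
import Summits.CriticalPhenomena.CardyFormulaZ2.Theses.CardySelfRefinement
import Summits.CriticalPhenomena.CardyFormulaZ2.Theses.CardyStressTensorWard
import Summits.CriticalPhenomena.CardyFormulaZ2.Theses.CardySublatticeCoherence
import Summits.CriticalPhenomena.CardyFormulaZ2.Theses.CardySusyWard
import Summits.CriticalPhenomena.CardyFormulaZ2.Theses.CardyTensorRG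
import Summits.CriticalPhenomena.CardyFormulaZ2.Theses.CardyTotalPositivity
import Summits.CriticalPhenomena.CardyFormulaZ2.Theses.CardyUSTContinuation
import Summits.CriticalPhenomena.CardyFormulaZ2.Theses.CardyUniqueLimit
import Summits.CriticalPhenomena.CardyFormulaZ2.Theses.CardyViaSLE6
import Summits.CriticalPhenomena.CardyFormulaZ2.Theses.CardyWhiteToColoured
import Summits.CriticalPhenomena.CardyFormulaZ2.Theses.CardyWickAnisotropy
import Summits.CriticalPhenomena.CardyFormulaZ2.Theses.CardyWindingIG
import Summits.CriticalPhenomena.CardyFormulaZ2.Theses.CoveringRateTransfer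
import Summits.CriticalPhenomena.CardyFormulaZ2.Theses.DWavePairKernel
import Summits.CriticalPhenomena.CardyFormulaZ2.Theses.DyadicBetaRigidity
import Summits.CriticalPhenomena.CardyFormulaZ2.Theses.ModulusResponse
import Summits.CriticalPhenomena.CardyFormulaZ2.Theses.PivotalEnergyLaw
import Summits.CriticalPhenomena.CardyFormulaZ2.Theses.QuarterTurnNoGo
import Summits.CriticalPhenomena.CardyFormulaZ2.Theses.SeamPivotalNoGo
import Summits.CriticalPhenomena.CardyFormulaZ2.Theses.UnionJackBeffara
import Summits.CriticalPhenomena.Ising3DConformalLimit.Theses.AnomalousForcesInteraction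
import Summits.CriticalPhenomena.Ising3DConformalLimit.Theses.ArmDressing
import Summits.CriticalPhenomena.Ising3DConformalLimit.Theses.ArmHyperscaling
import Summits.CriticalPhenomena.Ising3DConformalLimit.Theses.BallOrbitComparison
import Summits.CriticalPhenomena.Ising3DConformalLimit.Theses.BallSpecification
import Summits.CriticalPhenomena.Ising3DConformalLimit.Theses.BernsteinTemperature
import Summits.CriticalPhenomena.Ising3DConformalLimit.Theses.CanonicalBranchRefutation
import Summits.CriticalPhenomena.Ising3DConformalLimit.Theses.ClusterRigidity
import Summits.CriticalPhenomena.Ising3DConformalLimit.Theses.CoerciveSharpness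
import Summits.CriticalPhenomena.Ising3DConformalLimit.Theses.ConformalPoissonDevice
import Summits.CriticalPhenomena.Ising3DConformalLimit.Theses.CurrentConnectionInvariance
import Summits.CriticalPhenomena.Ising3DConformalLimit.Theses.DiracCensus
import Summits.CriticalPhenomena.Ising3DConformalLimit.Theses.EnergyNotSigmaSquared
import Summits.CriticalPhenomena.Ising3DConformalLimit.Theses.FKParityRobustness
import Summits.CriticalPhenomena.Ising3DConformalLimit.Theses.FilmLadder
import Summits.CriticalPhenomena.Ising3DConformalLimit.Theses.FourToThreeSlab
import Summits.CriticalPhenomena.Ising3DConformalLimit.Theses.GammaForcesInteraction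
import Summits.CriticalPhenomena.Ising3DConformalLimit.Theses.GaussianScaleMixture
import Summits.CriticalPhenomena.Ising3DConformalLimit.Theses.HalfHolomorphic
import Summits.CriticalPhenomena.Ising3DConformalLimit.Theses.HarmonicMomentsIsotropy
import Summits.CriticalPhenomena.Ising3DConformalLimit.Theses.HelsonAxis
import Summits.CriticalPhenomena.Ising3DConformalLimit.Theses.HyperoctahedralRP
import Summits.CriticalPhenomena.Ising3DConformalLimit.Theses.InverseSquareTelemetry
import Summits.CriticalPhenomena.Ising3DConformalLimit.Theses.IsingCFTData
import Summits.CriticalPhenomena.Ising3DConformalLimit.Theses.IsingEuclidUpgrade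
import Summits.CriticalPhenomena.Ising3DConformalLimit.Theses.LatticeSDPCertificates
import Summits.CriticalPhenomena.Ising3DConformalLimit.Theses.LeeYangGap
import Summits.CriticalPhenomena.Ising3DConformalLimit.Theses.LinkingParityCircles
import Summits.CriticalPhenomena.Ising3DConformalLimit.Theses.LocalisationClock
import Summits.CriticalPhenomena.Ising3DConformalLimit.Theses.LogPolarProxy
import Summits.CriticalPhenomena.Ising3DConformalLimit.Theses.LongRangeEndpoint
import Summits.CriticalPhenomena.Ising3DConformalLimit.Theses.MarkovRigidity
import Summits.CriticalPhenomena.Ising3DConformalLimit.Theses.MeanCurrentCircleLaw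
import Summits.CriticalPhenomena.Ising3DConformalLimit.Theses.MirrorHoelderCompactness
import Summits.CriticalPhenomena.Ising3DConformalLimit.Theses.ModularBoosts
import Summits.CriticalPhenomena.Ising3DConformalLimit.Theses.ModularQuarterTurn
import Summits.CriticalPhenomena.Ising3DConformalLimit.Theses.MoebiusRestrictionCurrents
import Summits.CriticalPhenomena.Ising3DConformalLimit.Theses.MonotoneBlocking
import Summits.CriticalPhenomena.Ising3DConformalLimit.Theses.MonotoneRG
import Summits.CriticalPhenomena.Ising3DConformalLimit.Theses.OctantEntropy
import Summits.CriticalPhenomena.Ising3DConformalLimit.Theses.OctaveForgetting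
import Summits.CriticalPhenomena.Ising3DConformalLimit.Theses.OrthogonalFrameTP2
import Summits.CriticalPhenomena.Ising3DConformalLimit.Theses.PerfectScreening
import Summits.CriticalPhenomena.Ising3DConformalLimit.Theses.PersistenceSpeed
import Summits.CriticalPhenomena.Ising3DConformalLimit.Theses.PlanarCornerRotations
import Summits.CriticalPhenomena.Ising3DConformalLimit.Theses.PlantedPinning
import Summits.CriticalPhenomena.Ising3DConformalLimit.Theses.PositivityBegetsConformality
import Summits.CriticalPhenomena.Ising3DConformalLimit.Theses.PrecisionLaplacian
import Summits.CriticalPhenomena.Ising3DConformalLimit.Theses.PrimaryAtInfinity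
import Summits.CriticalPhenomena.Ising3DConformalLimit.Theses.ReflectionTwin
import Summits.CriticalPhenomena.Ising3DConformalLimit.Theses.SignedFieldRestoration
import Summits.CriticalPhenomena.Ising3DConformalLimit.Theses.SubPtolemyInterlacing
import Summits.CriticalPhenomena.Ising3DConformalLimit.Theses.SynchronousCoupling
import Summits.CriticalPhenomena.Ising3DConformalLimit.Theses.TauBallRounding
import Summits.CriticalPhenomena.Ising3DConformalLimit.Theses.ThresholdDilation
import Summits.CriticalPhenomena.Ising3DConformalLimit.Theses.UnitLightCone
import Summits.CriticalPhenomena.Ising3DConformalLimit.Theses.VolterraWard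
import Summits.CriticalPhenomena.Ising3DConformalLimit.Theses.WeylWindow
import Summits.CriticalPhenomena.PercolationContinuityZ3.Theses.PercAnnulusCrossing
import Summits.CriticalPhenomena.PercolationContinuityZ3.Theses.PercAntiMeanFieldOnset
import Summits.CriticalPhenomena.PercolationContinuityZ3.Theses.PercAxialLogConvexity
import Summits.CriticalPhenomena.PercolationContinuityZ3.Theses.PercBoostCapacity
import Summits.CriticalPhenomena.PercolationContinuityZ3.Theses.PercBoundarySqueeze
import Summits.CriticalPhenomena.PercolationContinuityZ3.Theses.PercBudgetLadder
import Summits.CriticalPhenomena.PercolationContinuityZ3.Theses.PercBurnResprinkle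
import Summits.CriticalPhenomena.PercolationContinuityZ3.Theses.PercCCDGraph
import Summits.CriticalPhenomena.PercolationContinuityZ3.Theses.PercClusterResistance
import Summits.CriticalPhenomena.PercolationContinuityZ3.Theses.PercCriticalCaps
import Summits.CriticalPhenomena.PercolationContinuityZ3.Theses.PercDebrisSweep
import Summits.CriticalPhenomena.PercolationContinuityZ3.Theses.PercDiodeSteering
import Summits.CriticalPhenomena.PercolationContinuityZ3.Theses.PercDislocationCovers
import Summits.CriticalPhenomena.PercolationContinuityZ3.Theses.PercDivergentSlabLadder
import Summits.CriticalPhenomena.PercolationContinuityZ3.Theses.PercDustRigidity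
import Summits.CriticalPhenomena.PercolationContinuityZ3.Theses.PercDustSandwich
import Summits.CriticalPhenomena.PercolationContinuityZ3.Theses.PercEventualDensity
import Summits.CriticalPhenomena.PercolationContinuityZ3.Theses.PercExchangeRateTransport
import Summits.CriticalPhenomena.PercolationContinuityZ3.Theses.PercFiniteBoxLRO
import Summits.CriticalPhenomena.PercolationContinuityZ3.Theses.PercFluxFromDensity
import Summits.CriticalPhenomena.PercolationContinuityZ3.Theses.PercFoamCut
import Summits.CriticalPhenomena.PercolationContinuityZ3.Theses.PercGamblersRuin
import Summits.CriticalPhenomena.PercolationContinuityZ3.Theses.PercHalfSpace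
import Summits.CriticalPhenomena.PercolationContinuityZ3.Theses.PercHollowCells
import Summits.CriticalPhenomena.PercolationContinuityZ3.Theses.PercHyperscalingGluing
import Summits.CriticalPhenomena.PercolationContinuityZ3.Theses.PercLayerChain
import Summits.CriticalPhenomena.PercolationContinuityZ3.Theses.PercLevelPieceIsoperimetry
import Summits.CriticalPhenomena.PercolationContinuityZ3.Theses.PercLevyKhintchine
import Summits.CriticalPhenomena.PercolationContinuityZ3.Theses.PercLongRangeCatalyst
import Summits.CriticalPhenomena.PercolationContinuityZ3.Theses.PercLoopDislocationCovers
import Summits.CriticalPhenomena.PercolationContinuityZ3.Theses.PercLowPointHalfSpace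
import Summits.CriticalPhenomena.PercolationContinuityZ3.Theses.PercLupuEnvironment
import Summits.CriticalPhenomena.PercolationContinuityZ3.Theses.PercMinContact
import Summits.CriticalPhenomena.PercolationContinuityZ3.Theses.PercMonotoneFactors
import Summits.CriticalPhenomena.PercolationContinuityZ3.Theses.PercNearOneGluing
import Summits.CriticalPhenomena.PercolationContinuityZ3.Theses.PercNearOneGluingNoHeavy
import Summits.CriticalPhenomena.PercolationContinuityZ3.Theses.PercNecklaceBackbone
import Summits.CriticalPhenomena.PercolationContinuityZ3.Theses.PercNonProliferation
import Summits.CriticalPhenomena.PercolationContinuityZ3.Theses.PercNonSelfAveraging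
import Summits.CriticalPhenomena.PercolationContinuityZ3.Theses.PercOpenSupercrit
import Summits.CriticalPhenomena.PercolationContinuityZ3.Theses.PercPorousCritical
import Summits.CriticalPhenomena.PercolationContinuityZ3.Theses.PercPortalLadder
import Summits.CriticalPhenomena.PercolationContinuityZ3.Theses.PercPotemkinWeaver
import Summits.CriticalPhenomena.PercolationContinuityZ3.Theses.PercQuarantineIslands
import Summits.CriticalPhenomena.PercolationContinuityZ3.Theses.PercRayRenewal
import Summits.CriticalPhenomena.PercolationContinuityZ3.Theses.PercReliabilityThinning
import Summits.CriticalPhenomena.PercolationContinuityZ3.Theses.PercShatteringRace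
import Summits.CriticalPhenomena.PercolationContinuityZ3.Theses.PercSieveRigidity
import Summits.CriticalPhenomena.PercolationContinuityZ3.Theses.PercSubharmonicSquare
import Summits.CriticalPhenomena.PercolationContinuityZ3.Theses.PercSupergraphDichotomy
import Summits.CriticalPhenomena.PercolationContinuityZ3.Theses.PercThresholdOne
import Summits.CriticalPhenomena.PercolationContinuityZ3.Theses.PercTiltedBlockers
import Summits.CriticalPhenomena.PercolationContinuityZ3.Theses.PercTorusSliceFilling
import Summits.CriticalPhenomena.PercolationContinuityZ3.Theses.PercTreeValue
import Summits.CriticalPhenomena.PercolationContinuityZ3.Theses.PercTruncatedSusceptibility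
import Summits.CriticalPhenomena.PercolationContinuityZ3.Theses.PercTwoPointDecay
import Summits.CriticalPhenomena.PercolationContinuityZ3.Theses.PercVarianceSandwich
import Summits.CriticalPhenomena.SAWScalingLimit.Theses.SAWAlgebraicCriticalPoint
import Summits.CriticalPhenomena.SAWScalingLimit.Theses.SAWAsymptoticMorera
import Summits.CriticalPhenomena.SAWScalingLimit.Theses.SAWBetheAnsatz
import Summits.CriticalPhenomena.SAWScalingLimit.Theses.SAWBrickWallHomotopy
import Summits.CriticalPhenomena.SAWScalingLimit.Theses.SAWBrownianDomination
import Summits.CriticalPhenomena.SAWScalingLimit.Theses.SAWChargeContinuation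
import Summits.CriticalPhenomena.SAWScalingLimit.Theses.SAWCircleScreening
import Summits.CriticalPhenomena.SAWScalingLimit.Theses.SAWCompassLattice
import Summits.CriticalPhenomena.SAWScalingLimit.Theses.SAWConePseudogroup
import Summits.CriticalPhenomena.SAWScalingLimit.Theses.SAWConfRestriction
import Summits.CriticalPhenomena.SAWScalingLimit.Theses.SAWCutPointCondensation
import Summits.CriticalPhenomena.SAWScalingLimit.Theses.SAWDefectDecoherence
import Summits.CriticalPhenomena.SAWScalingLimit.Theses.SAWDeterminantalDiagonal
import Summits.CriticalPhenomena.SAWScalingLimit.Theses.SAWDevelopingMap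
import Summits.CriticalPhenomena.SAWScalingLimit.Theses.SAWDimerizationRG
import Summits.CriticalPhenomena.SAWScalingLimit.Theses.SAWDiscreteFlowLine
import Summits.CriticalPhenomena.SAWScalingLimit.Theses.SAWEdgeOfPositiveType
import Summits.CriticalPhenomena.SAWScalingLimit.Theses.SAWEdwardsStrongCoupling
import Summits.CriticalPhenomena.SAWScalingLimit.Theses.SAWExcursionCardy
import Summits.CriticalPhenomena.SAWScalingLimit.Theses.SAWExpCovariance
import Summits.CriticalPhenomena.SAWScalingLimit.Theses.SAWExpectedSignature
import Summits.CriticalPhenomena.SAWScalingLimit.Theses.SAWFrontierHomotopy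
import Summits.CriticalPhenomena.SAWScalingLimit.Theses.SAWGaussianRotation
import Summits.CriticalPhenomena.SAWScalingLimit.Theses.SAWHexUniversality
import Summits.CriticalPhenomena.SAWScalingLimit.Theses.SAWImaginaryGeometry
import Summits.CriticalPhenomena.SAWScalingLimit.Theses.SAWInfinitesimalRigidity
import Summits.CriticalPhenomena.SAWScalingLimit.Theses.SAWIsotropicAnchor
import Summits.CriticalPhenomena.SAWScalingLimit.Theses.SAWLaplacianWalk
import Summits.CriticalPhenomena.SAWScalingLimit.Theses.SAWLatticeVirasoro
import Summits.CriticalPhenomena.SAWScalingLimit.Theses.SAWLeftRightFKG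
import Summits.CriticalPhenomena.SAWScalingLimit.Theses.SAWLoopAvoidanceChaos
import Summits.CriticalPhenomena.SAWScalingLimit.Theses.SAWLoopFugacityFlow
import Summits.CriticalPhenomena.SAWScalingLimit.Theses.SAWLoopLift
import Summits.CriticalPhenomena.SAWScalingLimit.Theses.SAWMassiveIsingTilt
import Summits.CriticalPhenomena.SAWScalingLimit.Theses.SAWParafermion
import Summits.CriticalPhenomena.SAWScalingLimit.Theses.SAWPhaseRetrieval
import Summits.CriticalPhenomena.SAWScalingLimit.Theses.SAWPoincareChain
import Summits.CriticalPhenomena.SAWScalingLimit.Theses.SAWPoissonBanks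
import Summits.CriticalPhenomena.SAWScalingLimit.Theses.SAWPoissonHoneycomb
import Summits.CriticalPhenomena.SAWScalingLimit.Theses.SAWPoissonSubstrate
import Summits.CriticalPhenomena.SAWScalingLimit.Theses.SAWPtolemyBoundary
import Summits.CriticalPhenomena.SAWScalingLimit.Theses.SAWQuadrupoleWard
import Summits.CriticalPhenomena.SAWScalingLimit.Theses.SAWQuantumGravity
import Summits.CriticalPhenomena.SAWScalingLimit.Theses.SAWQuarterTwist
import Summits.CriticalPhenomena.SAWScalingLimit.Theses.SAWRenewalTightness
import Summits.CriticalPhenomena.SAWScalingLimit.Theses.SAWResidueField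
import Summits.CriticalPhenomena.SAWScalingLimit.Theses.SAWRestrictionDescent
import Summits.CriticalPhenomena.SAWScalingLimit.Theses.SAWRestrictionRigidity
import Summits.CriticalPhenomena.SAWScalingLimit.Theses.SAWReversalUpgrade
import Summits.CriticalPhenomena.SAWScalingLimit.Theses.SAWRingGibbsDescent
import Summits.CriticalPhenomena.SAWScalingLimit.Theses.SAWSchrammPassage
import Summits.CriticalPhenomena.SAWScalingLimit.Theses.SAWSpinMonotone
import Summits.CriticalPhenomena.SAWScalingLimit.Theses.SAWSteinDefect
import Summits.CriticalPhenomena.SAWScalingLimit.Theses.SAWStochasticQuantisation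
import Summits.CriticalPhenomena.SAWScalingLimit.Theses.SAWStressTensor
import Summits.CriticalPhenomena.SAWScalingLimit.Theses.SAWTargetMonotonicity
import Summits.CriticalPhenomena.SAWScalingLimit.Theses.SAWTensorRG
import Summits.CriticalPhenomena.SAWScalingLimit.Theses.SAWThetaPercolation
import Summits.CriticalPhenomena.SAWScalingLimit.Theses.SAWTiltedExplorer
import Summits.CriticalPhenomena.SAWScalingLimit.Theses.SAWTipEnvironment
import Summits.CriticalPhenomena.SAWScalingLimit.Theses.SAWTotalPositivity
import Summits.CriticalPhenomena.SAWScalingLimit.Theses.SAWTowerCount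
import Summits.CriticalPhenomena.SAWScalingLimit.Theses.SAWTrackTransport
import Summits.CriticalPhenomena.SAWScalingLimit.Theses.SAWTurnDefect
import Summits.CriticalPhenomena.SAWScalingLimit.Theses.SAWTwistedSelfEnergy
import Summits.CriticalPhenomena.SAWScalingLimit.Theses.SAWWeldingIdentification
import Summits.CriticalPhenomena.SAWScalingLimit.Theses.SAWWindingAlias
import Summits.CriticalPhenomena.SAWScalingLimit.Theses.SAWZoomRigidity
import Summits.CriticalPhenomena.PercolationContinuityZ3.Cruxes.SupercritExchangeUniformity.FwdRungG32
import Summits.CriticalPhenomena.Ising3DConformalLimit.Theorems.MonotoneBlockingLimitsAreConformalSummit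
import Summits.CriticalPhenomena.CardyFormulaZ2.Theorems.CardyBoundaryCoulombGasHalfPlaneMarkDensityLawSubseqRigidityCorollaries
import Summits.CriticalPhenomena.CardyFormulaZ2.Theorems.CardyWickAnisotropyBoxFamilyToCardyTightness
import Summits.CriticalPhenomena.CardyFormulaZ2.Theorems.CardyBoundaryCoulombGasHalfPlaneMarkDensityLawRigidityCorollaries
import Summits.CriticalPhenomena.CardyFormulaZ2.Theorems.CardyIKTransportCornerLineDescentSummitStrength
import Summits.CriticalPhenomena.CardyFormulaZ2.Cruxes.HalfStripCardyZ2.Necessity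
import Summits.CriticalPhenomena.PercolationContinuityZ3.Cruxes.FiniteClusterVolumeTail.ReExamQuarantineIslands
import Summits.CriticalPhenomena.PercolationContinuityZ3.Cruxes.FiniteClusterVolumeTail.ReExamPercPorousCritical
import Summits.CriticalPhenomena.PercolationContinuityZ3.Cruxes.FiniteClusterVolumeTail.StrategyCensus
import Summits.CriticalPhenomena.PercolationContinuityZ3.Cruxes.MacroCutLog.StrategyCensus
import Summits.CriticalPhenomena.PercolationContinuityZ3.Theorems.PercPorousCriticalFiniteClusterVolumeTailSummitEquiv
import Summits.CriticalPhenomena.PercolationContinuityZ3.Theorems.PercLowPointHalfSpaceAssemblyReduction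
import Summits.CriticalPhenomena.CardyFormulaZ2.Cruxes.CornerLineDescent.CensusR1
import Summits.CriticalPhenomena.PercolationContinuityZ3.Theorems.PercLowPointHalfSpaceLowPointBookkeepingLevelCount
import Summits.CriticalPhenomena.PercolationContinuityZ3.Theorems.SoloInformedSlabCriticalDensity
import Summits.CriticalPhenomena.CardyFormulaZ2.Theorems.CardyBoundaryCoulombGasHalfPlaneMarkDensityLawNecessity
import Summits.CriticalPhenomena.PercolationContinuityZ3.Cruxes.TruncatedSusceptibilityFiniteOfTheta.StrategyCensus
import Summits.CriticalPhenomena.PercolationContinuityZ3.Theorems.PercNearOneGluingNoHeavyLowerTailKNConjecturesOfS5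
import Summits.CriticalPhenomena.CardyFormulaZ2.Theorems.CardyComplexConeParafermionToSLESixFamiliesFlipAllDomainsOfDiag
import Summits.CriticalPhenomena.PercolationContinuityZ3.Theorems.PercLowPointHalfSpaceAssemblyColumnTelescoping
import Summits.CriticalPhenomena.CardyFormulaZ2.Cruxes.ExplorationHitCardy.Costume
import Summits.CriticalPhenomena.CardyFormulaZ2.Cruxes.HalfStripCardyZ2.StrategyCensus
import Summits.CriticalPhenomena.CardyFormulaZ2.Cruxes.UniformRefinementDominance.SImpliesC
import Summits.CriticalPhenomena.CardyFormulaZ2.Theorems.CardyBoundaryCoulombGasStripClusterRatesOfCardyFormulaZ2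
import Summits.CriticalPhenomena.Ising3DConformalLimit.Cruxes.MonotoneRounding.StrategistR1SummitCone
import Summits.CriticalPhenomena.Ising3DConformalLimit.Cruxes.UniformRegularity.RedirectCertificateR1
import Summits.CriticalPhenomena.Ising3DConformalLimit.Theorems.CanonicalBranchRefutationInfraredExponentZeroConjunct
import Summits.CriticalPhenomena.PercolationContinuityZ3.Theorems.PercBudgetLadderPinholeClosingDichotomy
import Summits.CriticalPhenomena.PercolationContinuityZ3.Theorems.PercLowPointHalfSpaceLowPointBookkeepingStemCriterion
import Summits.CriticalPhenomena.PercolationContinuityZ3.Theorems.PercNonProliferationSubpolynomialBlockingMeanSpanningTradeoff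
import Summits.CriticalPhenomena.SAWScalingLimit.Cruxes.YBtoUniform.KernelSummitEquivalent
import Summits.CriticalPhenomena.CardyFormulaZ2.Cruxes.CardyOneStep.Strength
import Summits.CriticalPhenomena.Ising3DConformalLimit.Cruxes.IsingLimitLightCone.RedirectAudit
import Summits.CriticalPhenomena.PercolationContinuityZ3.Cruxes.NearLinearTwoClusterDecay.ClosureR1
import Summits.CriticalPhenomena.PercolationContinuityZ3.Theorems.PercBoundarySqueezeFreeBoxFatClusterMassJumpReduction
import Summits.CriticalPhenomena.PercolationContinuityZ3.Theorems.PercLowPointHalfSpaceAssembly2Glue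
import Summits.CriticalPhenomena.PercolationContinuityZ3.Theorems.PercLowPointHalfSpaceAssemblyRootAvoiding
import Summits.CriticalPhenomena.PercolationContinuityZ3.Theorems.PercNecklaceBackboneTruncatedSusceptibilityFiniteOfThetaOfBlocking
import Summits.CriticalPhenomena.PercolationContinuityZ3.Theorems.PercTreeValueTetrahedronLogConvexityCertStrength
import Summits.CriticalPhenomena.PercolationContinuityZ3.Theorems.SoloInformedCriticalSlabOneArm
import Summits.CriticalPhenomena.CardyFormulaZ2.Cruxes.BoxFamilyToCardy.Split
import Summits.CriticalPhenomena.CardyFormulaZ2.Cruxes.DyadicLatticeBetaLaw.Disproof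
import Summits.CriticalPhenomena.Ising3DConformalLimit.Cruxes.InversionPositiveLimit.CensusR1Separation
import Summits.CriticalPhenomena.Ising3DConformalLimit.Cruxes.JoiningsTransfer.Disproof
import Summits.CriticalPhenomena.Ising3DConformalLimit.Theorems.LeeYangGapSummitDescent
import Summits.CriticalPhenomena.PercolationContinuityZ3.Cruxes.FiniteClusterVolumeTail.FwdLadder
import Summits.CriticalPhenomena.PercolationContinuityZ3.Cruxes.GoodBoxesLikelyWhenPercolating.StrategyCensusR1
import Summits.CriticalPhenomena.PercolationContinuityZ3.Cruxes.SupercritExchangeUniformity.FwdRungG8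
import Summits.CriticalPhenomena.PercolationContinuityZ3.Theorems.PercRayRenewalJumpLineAvoidanceDecaySummitEquivalence
import Summits.CriticalPhenomena.SAWScalingLimit.Cruxes.SubseqIdentification.Disproof
import Summits.CriticalPhenomena.CardyFormulaZ2.Theorems.DyadicBetaRigidityDyadicLatticeBetaLawOfComparison
import Summits.CriticalPhenomena.Ising3DConformalLimit.Cruxes.IndependentStrandsJoin.StrategySketchS3
import Summits.CriticalPhenomena.Ising3DConformalLimit.Cruxes.TwistFluxConservation.Restated
import Summits.CriticalPhenomena.PercolationContinuityZ3.Cruxes.SupercritExchangeUniformity.FwdRungG17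
import Summits.CriticalPhenomena.PercolationContinuityZ3.Theorems.PercBoundarySqueezeFreeBoxFatClusterMassGiantScaleLRO
import Summits.CriticalPhenomena.PercolationContinuityZ3.Theorems.PercExchangeRateTransportIsotropicLocusContinuityOnPath
import Summits.CriticalPhenomena.PercolationContinuityZ3.Theorems.PercNecklaceBackboneTruncatedSusceptibilityFiniteOfThetaOfRayRenewal
import Summits.CriticalPhenomena.CardyFormulaZ2.Cruxes.NestingRigidity.SummitStrength
import Summits.CriticalPhenomena.CardyFormulaZ2.Cruxes.ParafermionToSLESixFamilies.Disproof
import Summits.CriticalPhenomena.CardyFormulaZ2.Theorems.CardyBoundaryCoulombGasStripClusterRatesTwoClusterUpperWindow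
import Summits.CriticalPhenomena.CardyFormulaZ2.Theorems.DyadicBetaRigidityDyadicLatticeBetaLawS1IffSubseqCI
import Summits.CriticalPhenomena.Ising3DConformalLimit.Cruxes.AxialHelsonCone.RedirectCertificateR1
import Summits.CriticalPhenomena.Ising3DConformalLimit.Cruxes.SpinRatioMoebius.SplitR1_Certificate
import Summits.CriticalPhenomena.PercolationContinuityZ3.Cruxes.TetrahedronHarrisGap.SketchStrategistR1
import Summits.CriticalPhenomena.PercolationContinuityZ3.Theorems.PercFiniteBoxLRORenormaliseFromLinearLROImplications
import Summits.CriticalPhenomena.PercolationContinuityZ3.Theorems.PercHyperscalingGluingBoxGluingReductions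
import Summits.CriticalPhenomena.PercolationContinuityZ3.Theorems.PercLowPointHalfSpaceTallClusterMassBoundRestatement
import Summits.CriticalPhenomena.PercolationContinuityZ3.Theorems.PercPorousCriticalFiniteClusterVolumeTailPosition
import Summits.CriticalPhenomena.PercolationContinuityZ3.Theorems.PercTreeValueTetrahedronHarrisGapCertStrength
import Summits.CriticalPhenomena.PercolationContinuityZ3.Theorems.SoloBlindPeriodicFinLadder
import Summits.CriticalPhenomena.PercolationContinuityZ3.Theorems.SoloInformedBenjaminiKalaiRSW
import Summits.CriticalPhenomena.PercolationContinuityZ3.Theorems.SoloInformedSquareBeamAssembly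
import Summits.CriticalPhenomena.SAWScalingLimit.Cruxes.HexTransfer.Disproof
import Summits.CriticalPhenomena.SAWScalingLimit.Theorems.ObservableToSLER.Negative.OrientationSilence
import Summits.CriticalPhenomena.CardyFormulaZ2.Cruxes.CardyRigidity.Disproof
import Summits.CriticalPhenomena.CardyFormulaZ2.Cruxes.ParafermionFamiliesToSLESix.Disproof
import Summits.CriticalPhenomena.CardyFormulaZ2.Theorems.CardyBoundaryCoulombGasStripClusterRatesTwoClusterLowerWindow
import Summits.CriticalPhenomena.CardyFormulaZ2.Theorems.CardySelfDualSegmentUniformMarginalityPointwiseBoxCrossing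
import Summits.CriticalPhenomena.Ising3DConformalLimit.Cruxes.AngularHierarchy.OffConeCertificate
import Summits.CriticalPhenomena.Ising3DConformalLimit.Cruxes.NelsonPolyakovRigidity.StrategistLocation
import Summits.CriticalPhenomena.PercolationContinuityZ3.Cruxes.ConeRung.Costume
import Summits.CriticalPhenomena.PercolationContinuityZ3.Cruxes.CritTruncatedSusceptibilityInfinite.StrategistSketchR1
import Summits.CriticalPhenomena.PercolationContinuityZ3.Cruxes.FreeBoxSparse.StrategyCensusR1
import Summits.CriticalPhenomena.PercolationContinuityZ3.Cruxes.TwoArmsRatioExponent.Dominance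
import Summits.CriticalPhenomena.PercolationContinuityZ3.Theorems.PercGamblersRuinBGNOffTheFloorStructure
import Summits.CriticalPhenomena.PercolationContinuityZ3.Theorems.PercLowPointHalfSpaceAssemblyShellCriterion
import Summits.CriticalPhenomena.PercolationContinuityZ3.Theorems.PercShatteringRaceNearLinearTwoClusterDecayRelayBootstrap
import Summits.CriticalPhenomena.PercolationContinuityZ3.Theorems.SoloInformedEpsilonCertificate
import Summits.CriticalPhenomena.CardyFormulaZ2.Theorems.CardyDualCurrentMartingaleToSLE6Split
import Summits.CriticalPhenomena.CardyFormulaZ2.Theorems.CardyMagicRigidityComposeAudit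
import Summits.CriticalPhenomena.PercolationContinuityZ3.Cruxes.FiniteClusterVolumeTail.HeightSqueezeSplit
import Summits.CriticalPhenomena.PercolationContinuityZ3.Cruxes.LowPointBookkeeping.SplitCanonicalGlue
import Summits.CriticalPhenomena.PercolationContinuityZ3.Theorems.NearLinearTwoClusterDecay.Negative.Structure
import Summits.CriticalPhenomena.PercolationContinuityZ3.Theorems.PercLowPointHalfSpaceAssembly2CrossTransport
import Summits.CriticalPhenomena.PercolationContinuityZ3.Theorems.PercLowPointHalfSpaceLowPointBookkeepingOfSharpStubs
import Summits.CriticalPhenomena.PercolationContinuityZ3.Theorems.PercLowPointHalfSpaceTallClusterMassBoundBypass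
import Summits.CriticalPhenomena.PercolationContinuityZ3.Theorems.PercNecklaceBackboneTruncatedSusceptibilityFiniteOfThetaOfBlockingSum
import Summits.CriticalPhenomena.PercolationContinuityZ3.Theorems.PercNonProliferationFreeBoxPowerSavingOneArmDictionary
import Summits.CriticalPhenomena.PercolationContinuityZ3.Theorems.PercShatteringRaceNearLinearTwoClusterDecayJumpForm
import Summits.CriticalPhenomena.PercolationContinuityZ3.Theorems.PercTreeValueTetrahedronHarrisGapRestrictedGluingWorld
import Summits.CriticalPhenomena.PercolationContinuityZ3.Theorems.SoloInformedJumpWorld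
import Summits.CriticalPhenomena.PercolationContinuityZ3.Theorems.SoloInformedSurfaceTensionVanishes
import Summits.CriticalPhenomena.SAWScalingLimit.Cruxes.YBtoUniform.SummitEquivalent
import Summits.CriticalPhenomena.SAWScalingLimit.Theorems.HexTransfer.Negative.RefutationCost
import Summits.CriticalPhenomena.SAWScalingLimit.Theorems.SAWCompassLatticeSurfaceUniversalitySummitEquivalent
import Summits.CriticalPhenomena.SAWScalingLimit.Theorems.SAWRenewalTightnessSubseqIdentificationNecessity
import Summits.CriticalPhenomena.SAWScalingLimit.Theorems.SAWTrackTransportYBtoUniformSummitEquivalent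
import Summits.CriticalPhenomena.CardyFormulaZ2.Cruxes.LogConvexApproach.R1ConjunctStructure
import Summits.CriticalPhenomena.CardyFormulaZ2.Cruxes.LoopsToCrossings.Disproof
import Summits.CriticalPhenomena.CardyFormulaZ2.Cruxes.ParafermionToSLESixFamilies.SummitStrengthR1
import Summits.CriticalPhenomena.CardyFormulaZ2.Theorems.CardyAnchoredRigiditySubseqCardyFrameTheorem
import Summits.CriticalPhenomena.CardyFormulaZ2.Theorems.CardyBoundaryCoulombGasAssembly
import Summits.CriticalPhenomena.CardyFormulaZ2.Theorems.CardyBoundaryCoulombGasHalfPlaneMarkDensityLawCollinearForm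
import Summits.CriticalPhenomena.CardyFormulaZ2.Theorems.CardyPolygonWordsAssembly
import Summits.CriticalPhenomena.CardyFormulaZ2.Theorems.CardySegmentWeakRSWClosedOfWeakBoxCrossingKernelVisible
import Summits.CriticalPhenomena.CardyFormulaZ2.Theorems.CardySelfRefinementSymmetryUpgradeRAllDomains
import Summits.CriticalPhenomena.Ising3DConformalLimit.Cruxes.DeviceWeylUniversality.Costume
import Summits.CriticalPhenomena.Ising3DConformalLimit.Cruxes.NonSeparableModulus.Disproof
import Summits.CriticalPhenomena.Ising3DConformalLimit.Theorems.InverseSquareTelemetryTwoPointSpineComplementAnatomy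
import Summits.CriticalPhenomena.PercolationContinuityZ3.Cruxes.EquilateralAntiFactorisation.Split
import Summits.CriticalPhenomena.PercolationContinuityZ3.Cruxes.NearLinearTwoClusterDecay.RestateCheck_c7
import Summits.CriticalPhenomena.PercolationContinuityZ3.Theorems.PercFiniteBoxLRORenormaliseFromLinearLROTwoArmsFrontier
import Summits.CriticalPhenomena.PercolationContinuityZ3.Theorems.PercHyperscalingGluingBoxGluingStructure
import Summits.CriticalPhenomena.PercolationContinuityZ3.Theorems.PercNearOneGluingNoHeavyLowerTailClosureAudit
import Summits.CriticalPhenomena.PercolationContinuityZ3.Theorems.PercNearOneGluingNoHeavyQuantOneArmIff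
import Summits.CriticalPhenomena.PercolationContinuityZ3.Theorems.PercNecklaceBackboneTruncatedSusceptibilityFiniteOfThetaDiableretsFromAbove
import Summits.CriticalPhenomena.PercolationContinuityZ3.Theorems.PercNonProliferationSubpolynomialBlockingFrequentlySuffices
import Summits.CriticalPhenomena.PercolationContinuityZ3.Theorems.PercRayRenewalJumpLineAvoidanceDecayUniformSupercritical
import Summits.CriticalPhenomena.PercolationContinuityZ3.Theorems.PercShatteringRaceNearLinearTwoClusterDecayConsumedFromPolyScaleLRO
import Summits.CriticalPhenomena.PercolationContinuityZ3.Theorems.PercShatteringRaceNearLinearTwoClusterDecayLinearRacePair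
import Summits.CriticalPhenomena.PercolationContinuityZ3.Theorems.PercTreeValueTetrahedronDisjointCoexistenceTransfer
import Summits.CriticalPhenomena.PercolationContinuityZ3.Theorems.SoloInformedMushroomLimit
import Summits.CriticalPhenomena.SAWScalingLimit.Cruxes.CanonicalLimit.Costume
import Summits.CriticalPhenomena.SAWScalingLimit.Theorems.SAWDevelopingMapHexTransferNoReturnToStart
import Summits.CriticalPhenomena.SAWScalingLimit.Theorems.SAWMassiveIsingTiltCriticalCurveContinuityReductions
import Summits.CriticalPhenomena.SAWScalingLimit.Theorems.SAWRenewalTightnessSubseqIdentificationWindowReduction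
import Summits.CriticalPhenomena.SAWScalingLimit.Theorems.SubseqIdentification.Negative.AlongMeshSplit
import Summits.CriticalPhenomena.CardyFormulaZ2.Cruxes.BondTriangularCardy.SketchR1
import Summits.CriticalPhenomena.CardyFormulaZ2.Cruxes.HalfPlaneMarkDensityLaw.StrategyCensus
import Summits.CriticalPhenomena.CardyFormulaZ2.Cruxes.RectilinearCardy.Disproof
import Summits.CriticalPhenomena.CardyFormulaZ2.Theorems.CardyBoundaryCoulombGasHalfPlaneMarkDensityLawHalfStripRigidity
import Summits.CriticalPhenomena.CardyFormulaZ2.Theorems.CardyBoundaryCoulombGasHalfPlaneMarkDensityLawOneArmThirdOfCrux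
import Summits.CriticalPhenomena.CardyFormulaZ2.Theorems.CardyBoundaryCoulombGasRectilinearCardyEngineMemberPosition
import Summits.CriticalPhenomena.CardyFormulaZ2.Theorems.CardyBoundaryCoulombGasRectilinearCardyStubClosureToConjunct
import Summits.CriticalPhenomena.CardyFormulaZ2.Theorems.CardyGluingRDEAssembly
import Summits.CriticalPhenomena.CardyFormulaZ2.Theorems.CardySegmentWeakRSWClosedOfWeakBoxCrossingOnPath
import Summits.CriticalPhenomena.CardyFormulaZ2.Theorems.CardyWhiteToColouredSimilarityUpgradeStubRectilinearSandwich
import Summits.CriticalPhenomena.CardyFormulaZ2.Theorems.ParafermionFamiliesToSLESix.Negative.VanishingWorld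
import Summits.CriticalPhenomena.Ising3DConformalLimit.Cruxes.DirectCorrelationStableTail.StrategistRouteCruxesDischarge
import Summits.CriticalPhenomena.Ising3DConformalLimit.Cruxes.LimitsAreConformal.Vetting
import Summits.CriticalPhenomena.Ising3DConformalLimit.Cruxes.MoebiusLimitExists.Disproof
import Summits.CriticalPhenomena.Ising3DConformalLimit.Theorems.AnomalousForcesInteractionEtaPositiveNecessity
import Summits.CriticalPhenomena.PercolationContinuityZ3.Cruxes.DropletSurfaceCost.Disproof
import Summits.CriticalPhenomena.PercolationContinuityZ3.Cruxes.FiniteClusterVolumeTail.DecompositionReexam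
import Summits.CriticalPhenomena.PercolationContinuityZ3.Cruxes.LowPointBookkeeping.Disproof
import Summits.CriticalPhenomena.PercolationContinuityZ3.Cruxes.LowPointBookkeeping.SketchIdeator2
import Summits.CriticalPhenomena.PercolationContinuityZ3.Cruxes.NearLinearTwoClusterDecay.Disproof
import Summits.CriticalPhenomena.PercolationContinuityZ3.Cruxes.NoHeavyLowerTail.Disproof
import Summits.CriticalPhenomena.PercolationContinuityZ3.Theorems.LowPointBookkeeping.Negative.LogicalStatus
import Summits.CriticalPhenomena.PercolationContinuityZ3.Theorems.PercBoundarySqueezeFreeBoxFatClusterMassGiantLRO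
import Summits.CriticalPhenomena.PercolationContinuityZ3.Theorems.PercBoundarySqueezeFreeBoxFatClusterMassGiantPolyLRO
import Summits.CriticalPhenomena.PercolationContinuityZ3.Theorems.PercGamblersRuinBGNOffTheFloorBridges
import Summits.CriticalPhenomena.PercolationContinuityZ3.Theorems.PercGamblersRuinBGNOffTheFloorLinearLRO
import Summits.CriticalPhenomena.PercolationContinuityZ3.Theorems.PercHyperscalingGluingBoxGluingStubBoxRestriction
import Summits.CriticalPhenomena.PercolationContinuityZ3.Theorems.PercNecklaceBackboneNoBackboneBirthGlue
import Summits.CriticalPhenomena.PercolationContinuityZ3.Theorems.PercNonProliferationFreeBoxSparseOfSubquadraticChi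
import Summits.CriticalPhenomena.PercolationContinuityZ3.Theorems.PercNonProliferationFreeBoxSparseQuarantine
import Summits.CriticalPhenomena.PercolationContinuityZ3.Theorems.PercNonProliferationNonProliferationFewClasses
import Summits.CriticalPhenomena.PercolationContinuityZ3.Theorems.PercRayRenewalTwoArmsRatioExponentDominance
import Summits.CriticalPhenomena.PercolationContinuityZ3.Theorems.PercRayRenewalTwoArmsRatioExponentFSNormalForms
import Summits.CriticalPhenomena.PercolationContinuityZ3.Theorems.PercShatteringRaceNearLinearTwoClusterDecaySplit
import Summits.CriticalPhenomena.PercolationContinuityZ3.Theorems.PercShatteringRaceRaceLemmaIO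
import Summits.CriticalPhenomena.PercolationContinuityZ3.Theorems.SoloBlindFinRungCriterion
import Summits.CriticalPhenomena.PercolationContinuityZ3.Theorems.SoloBlindOpenRungs
import Summits.CriticalPhenomena.PercolationContinuityZ3.Theorems.SoloBlindSlabEquicontinuity
import Summits.CriticalPhenomena.PercolationContinuityZ3.Theorems.SoloInformedMushroomDichotomy
import Summits.CriticalPhenomena.SAWScalingLimit.Cruxes.HexTight.Disproof
import Summits.CriticalPhenomena.SAWScalingLimit.Theorems.SAWBrickWallHomotopyModulusUniversalityBoundaryAvoidanceHexOfHexConjecture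
import Summits.CriticalPhenomena.SAWScalingLimit.Theorems.SAWDevelopingMapHexTransferNoBoundaryCreep
import Summits.CriticalPhenomena.SAWScalingLimit.Theorems.SAWRenewalTightnessEventualTightSketchDefs
import Summits.CriticalPhenomena.SAWScalingLimit.Theorems.SAWRenewalTightnessSubseqIdentificationRestrictionExactness
import Summits.CriticalPhenomena.CardyFormulaZ2.Cruxes.ConformalDilationCovariance.Split
import Summits.CriticalPhenomena.CardyFormulaZ2.Cruxes.RectilinearCardy.StrategyCensus
import Summits.CriticalPhenomena.CardyFormulaZ2.Theorems.CardyAnchoredRigiditySubseqCardySplit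
import Summits.CriticalPhenomena.CardyFormulaZ2.Theorems.CardyBoundaryCoulombGasBoundaryDefectGaussianRSummitHardness
import Summits.CriticalPhenomena.CardyFormulaZ2.Theorems.CardyBoundaryCoulombGasHalfPlaneMarkDensityLawWiredCardy
import Summits.CriticalPhenomena.CardyFormulaZ2.Theorems.CardyBoundaryCoulombGasStripClusterRatesCardyOrderTransfer
import Summits.CriticalPhenomena.CardyFormulaZ2.Theorems.CardyDualCurrentTemplateCanonicalLimit
import Summits.CriticalPhenomena.CardyFormulaZ2.Theorems.CardyFlipRussoCoveringLegTwins
import Summits.CriticalPhenomena.CardyFormulaZ2.Theorems.CardyGluingRDEMergingGivesPolygonCardy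
import Summits.CriticalPhenomena.CardyFormulaZ2.Theorems.CardyGluingRDEPolygonReduction
import Summits.CriticalPhenomena.CardyFormulaZ2.Theorems.CardyIKTransportCornerLineDescentRoutePosition
import Summits.CriticalPhenomena.CardyFormulaZ2.Theorems.CardyUSTContinuationUniformAnalyticExtensionTightness
import Summits.CriticalPhenomena.CardyFormulaZ2.Theorems.CardyWhiteToColouredSimilarityUpgradeC4Bedrock
import Summits.CriticalPhenomena.CardyFormulaZ2.Theorems.DyadicLatticeBetaLaw.Negative.StubEquicontinuousComparisonFalseWithoutModulus
import Summits.CriticalPhenomena.Ising3DConformalLimit.Cruxes.IndependentStrandsJoin.CensusSketchS9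
import Summits.CriticalPhenomena.Ising3DConformalLimit.Cruxes.JoinForcesU4.Disproof
import Summits.CriticalPhenomena.Ising3DConformalLimit.Cruxes.MergingFloor.CruxAttack
import Summits.CriticalPhenomena.Ising3DConformalLimit.Cruxes.NelsonPolyakovRigidity.RetargetGlueCheck
import Summits.CriticalPhenomena.Ising3DConformalLimit.Theorems.FKParityRobustnessIndependentStrandsJoinContinuumResidual
import Summits.CriticalPhenomena.Ising3DConformalLimit.Theorems.FKParityRobustnessIndependentStrandsJoinNonGaussianResidual
import Summits.CriticalPhenomena.Ising3DConformalLimit.Theorems.FKParityRobustnessSourceTrailsMeetStrands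
import Summits.CriticalPhenomena.Ising3DConformalLimit.Theorems.HelsonAxisTwoPointSpineComplementShared
import Summits.CriticalPhenomena.Ising3DConformalLimit.Theorems.LinkingParityCirclesSpinRatioMoebiusEquivalences
import Summits.CriticalPhenomena.Ising3DConformalLimit.Theorems.LogPolarProxyExistsContinuousLimitLimitContinuity
import Summits.CriticalPhenomena.Ising3DConformalLimit.Theorems.MonotoneBlockingNonSeparableModulusAxialPincer
import Summits.CriticalPhenomena.Ising3DConformalLimit.Theorems.PerfectScreeningMoebiusLimitExistsLatticeLeaves
import Summits.CriticalPhenomena.PercolationContinuityZ3.Cruxes.JumpFireBreak.Disproof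
import Summits.CriticalPhenomena.PercolationContinuityZ3.Cruxes.NearLinearTwoClusterDecay.TriageWorldsSplit_r2_1
import Summits.CriticalPhenomena.PercolationContinuityZ3.Cruxes.NonProliferation.JumpContinuousSplit
import Summits.CriticalPhenomena.PercolationContinuityZ3.Cruxes.QuantitativeBGN.SketchS2B
import Summits.CriticalPhenomena.PercolationContinuityZ3.Cruxes.SubcritExchangeUniformity.FwdRungG6
import Summits.CriticalPhenomena.PercolationContinuityZ3.Cruxes.SubpolynomialBlocking.Disproof
import Summits.CriticalPhenomena.PercolationContinuityZ3.Cruxes.SupercritExchangeUniformity.FwdRungG10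
import Summits.CriticalPhenomena.PercolationContinuityZ3.Cruxes.TetrahedronLogConvexity.SketchStrategist
import Summits.CriticalPhenomena.PercolationContinuityZ3.Cruxes.TorusNonProliferation.SplitCheck
import Summits.CriticalPhenomena.PercolationContinuityZ3.Cruxes.TwoArmFromDensity.SummitCostume
import Summits.CriticalPhenomena.PercolationContinuityZ3.Theorems.PercBoundarySqueezeFreeBoxFatClusterMassJumpSplit
import Summits.CriticalPhenomena.PercolationContinuityZ3.Theorems.PercBudgetLadderPinholeClosingShellHalving
import Summits.CriticalPhenomena.PercolationContinuityZ3.Theorems.PercBudgetLadderPinholeClosingZeroRung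
import Summits.CriticalPhenomena.PercolationContinuityZ3.Theorems.PercExchangeRateTransportSubcritExchangeUniformityClosesMono
import Summits.CriticalPhenomena.PercolationContinuityZ3.Theorems.PercFiniteBoxLROLinearScaleLROOfThetaEquivalences
import Summits.CriticalPhenomena.PercolationContinuityZ3.Theorems.PercHalfSpaceAssembly
import Summits.CriticalPhenomena.PercolationContinuityZ3.Theorems.PercMinContactMinContactExponentHalfMomentContinuity
import Summits.CriticalPhenomena.PercolationContinuityZ3.Theorems.PercMinContactMinContactExponentOfChiPowerLaw
import Summits.CriticalPhenomena.PercolationContinuityZ3.Theorems.PercMinContactTwoArmWindowBudget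
import Summits.CriticalPhenomena.PercolationContinuityZ3.Theorems.PercNearOneGluingNoHeavyAllDimensions
import Summits.CriticalPhenomena.PercolationContinuityZ3.Theorems.PercNearOneGluingNoHeavyLowerTailHubTransfer
import Summits.CriticalPhenomena.PercolationContinuityZ3.Theorems.PercNearOneGluingNoHeavyLowerTailKNConj1Holds
import Summits.CriticalPhenomena.PercolationContinuityZ3.Theorems.PercNecklaceBackboneTruncatedSusceptibilityFiniteOfThetaOfBlockingFamily
import Summits.CriticalPhenomena.PercolationContinuityZ3.Theorems.PercNecklaceBackboneTruncatedSusceptibilityFiniteOfThetaOfLineAvoidance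
import Summits.CriticalPhenomena.PercolationContinuityZ3.Theorems.PercNonProliferationAssembly
import Summits.CriticalPhenomena.PercolationContinuityZ3.Theorems.PercNonProliferationFreeBoxPowerSavingResidualDictionary
import Summits.CriticalPhenomena.PercolationContinuityZ3.Theorems.PercNonProliferationFreeBoxSparseParking
import Summits.CriticalPhenomena.PercolationContinuityZ3.Theorems.PercNonProliferationNonProliferationJumpContinuousSplit
import Summits.CriticalPhenomena.PercolationContinuityZ3.Theorems.PercNonProliferationPolynomialAssembly
import Summits.CriticalPhenomena.PercolationContinuityZ3.Theorems.PercNonSelfAveragingAssembly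
import Summits.CriticalPhenomena.PercolationContinuityZ3.Theorems.PercShatteringRaceFreeSusceptibilityPowerSavingTransferTG
import Summits.CriticalPhenomena.PercolationContinuityZ3.Theorems.PercShatteringRaceNearLinearTwoClusterDecayLinearRace
import Summits.CriticalPhenomena.PercolationContinuityZ3.Theorems.PercTiltedBlockersCubeBlockingSeedOfHeightHalving12
import Summits.CriticalPhenomena.PercolationContinuityZ3.Theorems.PercTiltedBlockersCubeBlockingSeedOfHeightHalvingAll
import Summits.CriticalPhenomena.PercolationContinuityZ3.Theorems.PercTreeValueAssembly
import Summits.CriticalPhenomena.PercolationContinuityZ3.Theorems.PercTreeValueAssemblyViaLogConvexity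
import Summits.CriticalPhenomena.PercolationContinuityZ3.Theorems.PercTreeValueTetrahedronDisjointCoexistenceTransferB
import Summits.CriticalPhenomena.PercolationContinuityZ3.Theorems.PercTreeValueTetrahedronDisjointCoexistenceTransferC
import Summits.CriticalPhenomena.PercolationContinuityZ3.Theorems.PercTreeValueTetrahedronDisjointCoexistenceTransferD
import Summits.CriticalPhenomena.PercolationContinuityZ3.Theorems.PercTreeValueTetrahedronHarrisGapCollarReductionByName
import Summits.CriticalPhenomena.PercolationContinuityZ3.Theorems.SoloBlindBoxCrossingCriterion
import Summits.CriticalPhenomena.PercolationContinuityZ3.Theorems.SoloBlindGirdleCriterion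
import Summits.CriticalPhenomena.PercolationContinuityZ3.Theorems.SoloBlindNearCubeCriterion
import Summits.CriticalPhenomena.PercolationContinuityZ3.Theorems.SoloBlindShellCriterion
import Summits.CriticalPhenomena.PercolationContinuityZ3.Theorems.SoloInformedAnnulusEntrance
import Summits.CriticalPhenomena.PercolationContinuityZ3.Theorems.SoloInformedBlockingIff
import Summits.CriticalPhenomena.PercolationContinuityZ3.Theorems.SoloInformedBoxCrossingFace
import Summits.CriticalPhenomena.PercolationContinuityZ3.Theorems.SoloInformedCrossingLowerBound
import Summits.CriticalPhenomena.PercolationContinuityZ3.Theorems.SoloInformedCubeFace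
import Summits.CriticalPhenomena.PercolationContinuityZ3.Theorems.SoloInformedSlabBoxFace
import Summits.CriticalPhenomena.PercolationContinuityZ3.Theorems.SoloInformedSummableSheets
import Summits.CriticalPhenomena.SAWScalingLimit.Cruxes.ConfCovLimit.StrategistSketch_s2
import Summits.CriticalPhenomena.SAWScalingLimit.Cruxes.EventualTight.Disproof
import Summits.CriticalPhenomena.SAWScalingLimit.Cruxes.HexConjecture.Disproof
import Summits.CriticalPhenomena.SAWScalingLimit.Cruxes.NoDeepReturn.NoDeepReturnNecessary
import Summits.CriticalPhenomena.SAWScalingLimit.Theorems.SAWBrickWallHomotopyModulusUniversalityBoundaryAvoidanceBWOfBWRobust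
import Summits.CriticalPhenomena.SAWScalingLimit.Theorems.SAWLoopFugacityFlowLimitAvoidanceValuesClosers
import Summits.CriticalPhenomena.SAWScalingLimit.Theorems.SAWMassiveIsingTiltLatticeUniversalityKernelUnderA
import Summits.CriticalPhenomena.SAWScalingLimit.Theorems.SAWWeldingIdentificationWeldingLawOfLimitNecessity
import Summits.CriticalPhenomena.CardyFormulaZ2.Cruxes.ParafermionToSLESixFamilies.StrategistSplit
import Summits.CriticalPhenomena.CardyFormulaZ2.Cruxes.SLESixFamiliesGiveCardy.Disproof
import Summits.CriticalPhenomena.CardyFormulaZ2.Cruxes.SegmentOpen.Disproof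
import Summits.CriticalPhenomena.CardyFormulaZ2.Theorems.CardyBoundaryCoulombGasHalfPlaneMarkDensityLawRigidity
import Summits.CriticalPhenomena.CardyFormulaZ2.Theorems.CardyComplexConeDiagSLESixGivesCardyDefs
import Summits.CriticalPhenomena.CardyFormulaZ2.Theorems.CardyComplexConeParafermionToSLESixFamiliesOfSlitMartingaleData
import Summits.CriticalPhenomena.CardyFormulaZ2.Theorems.CardyDualCurrentMartingaleToSLE6Reduction
import Summits.CriticalPhenomena.CardyFormulaZ2.Theorems.CardyFlipRussoCoveringLegUniversality
import Summits.CriticalPhenomena.CardyFormulaZ2.Theorems.CardyIKTransportCornerLineDescentOfIKBondBridge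
import Summits.CriticalPhenomena.CardyFormulaZ2.Theorems.CardyIKTransportIKLinearTransportMixedRSWBridge
import Summits.CriticalPhenomena.CardyFormulaZ2.Theorems.CardyIKTransportIKMixedBoxCrossingDefs
import Summits.CriticalPhenomena.CardyFormulaZ2.Theorems.CardyIKTransportIKMixedBoxCrossingXorDefs
import Summits.CriticalPhenomena.CardyFormulaZ2.Theorems.CardyMagicRigidityNestingRigidityTomographySelection
import Summits.CriticalPhenomena.CardyFormulaZ2.Theorems.CardySelfDualSegmentUniformMarginalityThreeCruxes
import Summits.CriticalPhenomena.CardyFormulaZ2.Theorems.CardySelfRefinementSymmetryUpgradeREquivR2R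
import Summits.CriticalPhenomena.CardyFormulaZ2.Theorems.CardySelfRefinementSymmetryUpgradeROfConjecture
import Summits.CriticalPhenomena.CardyFormulaZ2.Theorems.CardyTensorRGPolyominoToJordanStubLowerPolyominoSandwich
import Summits.CriticalPhenomena.CardyFormulaZ2.Theorems.CardyUSTContinuationUniformAnalyticExtensionSplit
import Summits.CriticalPhenomena.CardyFormulaZ2.Theorems.CardyWhiteToColouredSimilarityUpgradeHeartIffCrux
import Summits.CriticalPhenomena.CardyFormulaZ2.Theorems.CardyWickAnisotropyBoxFamilyToCardyTransport
import Summits.CriticalPhenomena.CardyFormulaZ2.Theorems.DyadicBetaRigidityDyadicBetaSuffices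
import Summits.CriticalPhenomena.CardyFormulaZ2.Theorems.DyadicBetaRigidityDyadicLatticeBetaLawStubCruxIffPolyomino
import Summits.CriticalPhenomena.CardyFormulaZ2.Theorems.ModulusResponseSegmentTransportKernelIffCrux
import Summits.CriticalPhenomena.CardyFormulaZ2.Theorems.ParafermionFamiliesToSLESix.Negative.CruxModuloBulkNondegenerate
import Summits.CriticalPhenomena.Ising3DConformalLimit.Cruxes.ExistsScaleCovariantLimit.SketchS1ULC
import Summits.CriticalPhenomena.Ising3DConformalLimit.Cruxes.ExistsScaleCovariantLimit.SplitPBC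
import Summits.CriticalPhenomena.Ising3DConformalLimit.Cruxes.FKFourConnectivity.Disproof
import Summits.CriticalPhenomena.Ising3DConformalLimit.Cruxes.NonSeparableModulus.NonSeparableModulusIffTwoPointDoubling
import Summits.CriticalPhenomena.Ising3DConformalLimit.Cruxes.PhiCoercive.ExitEntropySketch
import Summits.CriticalPhenomena.Ising3DConformalLimit.Cruxes.PinningEfficiencyDeficit.Sketch_s6
import Summits.CriticalPhenomena.Ising3DConformalLimit.Cruxes.UniformRegularity.Disproof
import Summits.CriticalPhenomena.Ising3DConformalLimit.Theorems.AnomalousForcesInteractionEtaPositiveProducers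
import Summits.CriticalPhenomena.Ising3DConformalLimit.Theorems.AnomalousForcesInteractionGaussianLimitIsFreeStubIffCrux
import Summits.CriticalPhenomena.Ising3DConformalLimit.Theorems.EnergyNotSigmaSquaredMoebiusLimitExistsHrpFactorisation
import Summits.CriticalPhenomena.Ising3DConformalLimit.Theorems.HarmonicMomentsIsotropyTwoPointAsymptoticIsotropy
import Summits.CriticalPhenomena.Ising3DConformalLimit.Theorems.HyperoctahedralRPExistsScaleCovariantLimitFoldedCurrentAxisCompleteMonotonicity
import Summits.CriticalPhenomena.Ising3DConformalLimit.Theorems.HyperoctahedralRPExistsScaleCovariantLimitFoldedCurrentAxisProfileFacts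
import Summits.CriticalPhenomena.Ising3DConformalLimit.Theorems.HyperoctahedralRPExistsScaleCovariantLimitFoldedCurrentSpectralEdgeDoubling
import Summits.CriticalPhenomena.Ising3DConformalLimit.Theorems.IsingCFTDataRefutations
import Summits.CriticalPhenomena.Ising3DConformalLimit.Theorems.JoinForcesU4.Negative.LoadBearing
import Summits.CriticalPhenomena.Ising3DConformalLimit.Theorems.LinkingParityCirclesSpinRatioMoebiusExistenceAvatars
import Summits.CriticalPhenomena.Ising3DConformalLimit.Theorems.LinkingParityCirclesSpinRatioMoebiusLineTightness
import Summits.CriticalPhenomena.Ising3DConformalLimit.Theorems.LinkingParityCirclesSpinRatioMoebiusRootCensus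
import Summits.CriticalPhenomena.Ising3DConformalLimit.Theorems.LogPolarProxyExistsContinuousLimitDoublingSplit
import Summits.CriticalPhenomena.Ising3DConformalLimit.Theorems.MonotoneRGExistsScaleCovariantLimitSplitGlue
import Summits.CriticalPhenomena.Ising3DConformalLimit.Theorems.PerfectScreeningMoebiusLimitExistsInversionPositive
import Summits.CriticalPhenomena.Ising3DConformalLimit.Theorems.PlantedPinningMoebiusLimitExistsTwoLeaf
import Summits.CriticalPhenomena.Ising3DConformalLimit.Theorems.PrecisionLaplacianMoebiusLimitOfTwoPointLawAmpLebIffInverseM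
import Summits.CriticalPhenomena.Ising3DConformalLimit.Theorems.PrimaryAtInfinityTwoPointPowerLawEta
import Summits.CriticalPhenomena.Ising3DConformalLimit.Theorems.SynchronousCouplingUniformRegularityMagneticRulerTransfer
import Summits.CriticalPhenomena.PercolationContinuityZ3.Cruxes.BoundaryTwoArmDecay.SplitCertificate
import Summits.CriticalPhenomena.PercolationContinuityZ3.Cruxes.CapAtCriticality.CensusLemmas
import Summits.CriticalPhenomena.PercolationContinuityZ3.Cruxes.FreeBoxSparse.Disproof
import Summits.CriticalPhenomena.PercolationContinuityZ3.Cruxes.FreeSusceptibilityPowerSaving.CensusSignaturesS1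
import Summits.CriticalPhenomena.PercolationContinuityZ3.Cruxes.FreeSusceptibilityPowerSaving.Disproof
import Summits.CriticalPhenomena.PercolationContinuityZ3.Cruxes.GoodBoxesLikelyWhenPercolating.StrategyCensus3826
import Summits.CriticalPhenomena.PercolationContinuityZ3.Cruxes.NonProliferation.Disproof
import Summits.CriticalPhenomena.PercolationContinuityZ3.Cruxes.NonProliferation.SplitCertificate
import Summits.CriticalPhenomena.PercolationContinuityZ3.Cruxes.NonProliferation.TenureSketch
import Summits.CriticalPhenomena.PercolationContinuityZ3.Cruxes.PortalGridRung.Costume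
import Summits.CriticalPhenomena.PercolationContinuityZ3.Cruxes.TallClusterMassBound.SketchIdeator4
import Summits.CriticalPhenomena.PercolationContinuityZ3.Cruxes.TallClusterMassBound.Triage_r2_2_Evidence
import Summits.CriticalPhenomena.PercolationContinuityZ3.Cruxes.VacantReignition.Disproof
import Summits.CriticalPhenomena.PercolationContinuityZ3.Cruxes.VacantSetPercolates.Disproof
import Summits.CriticalPhenomena.PercolationContinuityZ3.Theorems.FreeBoxSparse.Negative.OfContinuity
import Summits.CriticalPhenomena.PercolationContinuityZ3.Theorems.PercHyperscalingGluingBoxGluingOfCritAnnulusNonCrossing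
import Summits.CriticalPhenomena.PercolationContinuityZ3.Theorems.PercLowPointHalfSpaceAssemblyWallExit
import Summits.CriticalPhenomena.PercolationContinuityZ3.Theorems.PercLowPointHalfSpaceCrossBushBookkeepingRooting
import Summits.CriticalPhenomena.PercolationContinuityZ3.Theorems.PercMinContactAssembly
import Summits.CriticalPhenomena.PercolationContinuityZ3.Theorems.PercMinContactMinContactExponentHalfMoment
import Summits.CriticalPhenomena.PercolationContinuityZ3.Theorems.PercNearOneGluingKNSlabBridgeOfThm6
import Summits.CriticalPhenomena.PercolationContinuityZ3.Theorems.PercNearOneGluingNoHeavyConstsConj3SharpThreshold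
import Summits.CriticalPhenomena.PercolationContinuityZ3.Theorems.PercNearOneGluingNoHeavyLowerTailEventGluingSharp
import Summits.CriticalPhenomena.PercolationContinuityZ3.Theorems.PercNecklaceBackboneAssembly
import Summits.CriticalPhenomena.PercolationContinuityZ3.Theorems.PercNonProliferationNonProliferationFewClassesCalibration
import Summits.CriticalPhenomena.PercolationContinuityZ3.Theorems.PercNonProliferationNonProliferationFewClassesRatio
import Summits.CriticalPhenomena.PercolationContinuityZ3.Theorems.PercRayRenewalJumpLineAvoidanceDecayEquivalences
import Summits.CriticalPhenomena.PercolationContinuityZ3.Theorems.PercThresholdOneAssembly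
import Summits.CriticalPhenomena.PercolationContinuityZ3.Theorems.PercThresholdOneIsoperimetricClosing
import Summits.CriticalPhenomena.PercolationContinuityZ3.Theorems.PercTiltedBlockersAnnulusAssembly
import Summits.CriticalPhenomena.PercolationContinuityZ3.Theorems.PercTorusSliceFillingAssembly
import Summits.CriticalPhenomena.PercolationContinuityZ3.Theorems.PercTreeValueAssemblyViaDisjointCoexistence
import Summits.CriticalPhenomena.PercolationContinuityZ3.Theorems.PercTreeValueAssemblyViaThreePoint
import Summits.CriticalPhenomena.PercolationContinuityZ3.Theorems.PercTreeValueEquilateralAntiFactorisationFlowCertificate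
import Summits.CriticalPhenomena.PercolationContinuityZ3.Theorems.SoloBlindPerforatedWalls
import Summits.CriticalPhenomena.PercolationContinuityZ3.Theorems.SoloBlindPeriodicFinRate
import Summits.CriticalPhenomena.PercolationContinuityZ3.Theorems.SoloBlindPokeThrough
import Summits.CriticalPhenomena.PercolationContinuityZ3.Theorems.SoloBlindSlitRate
import Summits.CriticalPhenomena.PercolationContinuityZ3.Theorems.SoloInformedAnnulusProduct
import Summits.CriticalPhenomena.PercolationContinuityZ3.Theorems.SoloInformedBackboneSemicontinuity
import Summits.CriticalPhenomena.PercolationContinuityZ3.Theorems.SoloInformedBackboneTwoPoint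
import Summits.CriticalPhenomena.PercolationContinuityZ3.Theorems.SoloInformedMeanIntersectionGluing
import Summits.CriticalPhenomena.SAWScalingLimit.Cruxes.BulkScalingLimitExists.StrategySplit
import Summits.CriticalPhenomena.SAWScalingLimit.Cruxes.FKGToTraversalBound.Disproof
import Summits.CriticalPhenomena.SAWScalingLimit.Cruxes.FKGToTraversalBound.SplitGlueMatch
import Summits.CriticalPhenomena.SAWScalingLimit.Cruxes.ObservableToSLE.FloorRatioLimitRootPinning
import Summits.CriticalPhenomena.SAWScalingLimit.Cruxes.ObservableToSLER.Disproof
import Summits.CriticalPhenomena.SAWScalingLimit.Cruxes.ObservableToSLER.SplitGlue_s5a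
import Summits.CriticalPhenomena.SAWScalingLimit.Cruxes.ObservableToSLER.SplitSketch
import Summits.CriticalPhenomena.SAWScalingLimit.Cruxes.QCIdentification.Disproof
import Summits.CriticalPhenomena.SAWScalingLimit.Cruxes.QCIdentification.SketchIdeator16772k1
import Summits.CriticalPhenomena.SAWScalingLimit.Theorems.NoDeepReturn.Negative.SAWReversalUpgradeNecessary
import Summits.CriticalPhenomena.SAWScalingLimit.Theorems.SAWDefectDecoherenceObservableToSLERMacroRestrictionLimit
import Summits.CriticalPhenomena.SAWScalingLimit.Theorems.SAWDefectDecoherenceObservableToSLERResidueAssembly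
import Summits.CriticalPhenomena.SAWScalingLimit.Theorems.SAWDevelopingMapHexConjectureAvoidanceCocycleArch
import Summits.CriticalPhenomena.SAWScalingLimit.Theorems.SAWDevelopingMapObservableToSLETypeLadderBandDefs
import Summits.CriticalPhenomena.SAWScalingLimit.Theorems.SAWExcursionCardySimpleSubseqLimitsLatticeSplit
import Summits.CriticalPhenomena.SAWScalingLimit.Theorems.SAWExcursionCardySimpleSubseqLimitsSplit
import Summits.CriticalPhenomena.SAWScalingLimit.Theorems.SAWLoopFugacityFlowSimpleSubseqLimitsFirstHitLine
import Summits.CriticalPhenomena.SAWScalingLimit.Theorems.SAWLoopFugacityFlowSimpleSubseqLimitsPSRootReturnPinned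
import Summits.CriticalPhenomena.SAWScalingLimit.Theorems.SAWLoopFugacityFlowSimpleSubseqLimitsPSShadowDecayPinned
import Summits.CriticalPhenomena.SAWScalingLimit.Theorems.SAWMassiveIsingTiltLatticeUniversalityConvergentUpgrade
import Summits.CriticalPhenomena.SAWScalingLimit.Theorems.SAWRenewalTightnessShellCrossingBoundConfinementOfScalingLimit
import Summits.CriticalPhenomena.SAWScalingLimit.Theorems.SAWRenewalTightnessShellCrossingBoundIffEventualTight
import Summits.CriticalPhenomena.SAWScalingLimit.Theorems.SAWRestrictionRigidityLimitExists
import Summits.CriticalPhenomena.SAWScalingLimit.Theorems.SAWRestrictionRigidityLimitExistsCocycleOfScalingLimit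
import Summits.CriticalPhenomena.SAWScalingLimit.Theorems.SAWRestrictionRigidityLimitExistsNecessity
import Summits.CriticalPhenomena.SAWScalingLimit.Theorems.SAWRestrictionRigidityRigidityDiscCoreIffRepair
import Summits.CriticalPhenomena.SAWScalingLimit.Theorems.SAWSpinMonotoneQCIdentificationDefs
import Summits.CriticalPhenomena.SAWScalingLimit.Theorems.SAWWeldingIdentificationAssembly2
import Summits.CriticalPhenomena.SAWScalingLimit.Theorems.SAWWeldingIdentificationRemovableLimitS1IsSimpleSubseqLimits
import Summits.CriticalPhenomena.SAWScalingLimit.Theorems.SAWWeldingIdentificationWeldingLawOfLimitChordProxies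
import Summits.CriticalPhenomena.SAWScalingLimit.Theorems.SAWWeldingIdentificationWeldingLawOfLimitLatticeSandwich
import Summits.CriticalPhenomena.SAWScalingLimit.Theorems.SAWWeldingIdentificationWeldingLawOfLimitStableCut
import HarnessLib.Audit.TribunalTags
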